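import Summits.Ventures.PercRepro.S2GradedCount
import Summits.Ventures.PercRepro.S2MaxExtensionCount
import Summits.Ventures.PercRepro.S2DichotomyTools

/-!
# PercRepro — S2: THE TOP COUNT BY THE GRADED PARTITION COUNT (p7, gen 13; sub-claim S2; the cells `(14, 8 … 11)`)

`ThmN.topCount_le_payment_flat` with the graded partition count in place of the quart one: on the `e`-free core of rank `p` and
corank `d ≥ 6` with every rank-`≤ 5` set of `≤ f` points,
**`topCount_le_payment_graded`** — `#U(p, 5) ≤ V + σ_lo·(s3b·C(n − 3, 3) + s4b·C(n − 4, 2) + s5b·(n − 5) + C(d + 5, 6)) + (σ_hi − σ_lo)·N6/6`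
for any `V ≥ #{B : |B| = 5, E ∖ B spanning}` and any `N6 ≥ 6·#{S ∈ spanAll : |cl S| = f}`, `σ_lo = Σ_j C(f − 7, j)/quart(j + 1)`,
`σ_hi = Σ_j C(f − 6, j)/quart(j + 1)`; **`topCount_le_payment_graded_of_ext`** — the same with
`N6 = s3b·((n − 3)² − (n − 3))·e + 3·s4b·(n − 4)·e + 6·s5b·e + 6·C(d + 5, 6)` whenever `e` bounds the maximal extensions of every
rank-`4` flat with `≥ 5` points (S2MaxExtensionCount). Axioms: standard.
-/

open scoped Matroid

namespace PercRepro

namespace ThmN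

open Set

variable {α : Type}

open scoped Classical in
/-- **The top count at level `5` by the graded partition count**: the `5`-element top sets paid by `V`, the larger ones by
`σ_lo·Σ_k s_k·C(n − k, 6 − k) + (σ_hi − σ_lo)·N6/6` with `N6 ≥ 6·#{spanning 6-sets with a maximal closure}`. -/
theorem topCount_le_payment_graded (M : Matroid α) [M.Finite] (p d : ℕ) (hd6 : 6 ≤ d)
    (hR : M.eRank = (p : ℕ∞)) (hn : M.E.ncard = p + d)
    (hfree : ∀ e ∈ M.E, ∃ A ⊆ M.E \ {e}, e ∉ M.closure A ∧ e ∉ M.closure ((M.E \ {e}) \ A))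
    (f : ℕ) (hflat : ∀ X ⊆ M.E, M.eRk X ≤ 5 → X.ncard ≤ f)
    (s3b s4b s5b : ℕ) (hs3 : {C : Set α | M.IsCircuit C ∧ C.ncard = 3}.ncard ≤ s3b)
    (hs4 : {C : Set α | M.IsCircuit C ∧ C.ncard = 4}.ncard ≤ s4b)
    (hs5 : {C : Set α | M.IsCircuit C ∧ C.ncard = 5}.ncard ≤ s5b)
    (N6 : ℕ) (hN6 : ((S2.spanAll M 5).filter (fun S => (M.closure S).ncard = f)).card * 6 ≤ N6)
    (V : ℕ) (hV : {B : Set α | B ⊆ M.E ∧ B.ncard = 5 ∧ M.eRk (M.E \ B) = M.eRank}.ncard ≤ V) :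
    (Matroid.topCount M p 5 : ℚ) ≤ (V : ℚ) +
      (∑ j ∈ Finset.range (d - 5), (Nat.choose (f - 1 - 6) j : ℚ) / (((j + 1) + 3 * (j + 1).choose 2 + 3 * (j + 1).choose 3 + 2 * (j + 1).choose 4 : ℕ) : ℚ)) *
        ((s3b * (p + d - 3).choose 3 + s4b * (p + d - 4).choose 2 +
          s5b * (p + d - 5) + (d + 5).choose 6 : ℕ) : ℚ) +
      ((∑ j ∈ Finset.range (d - 5), (Nat.choose (f - 6) j : ℚ) / (((j + 1) + 3 * (j + 1).choose 2 + 3 * (j + 1).choose 3 + 2 * (j + 1).choose 4 : ℕ) : ℚ)) -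
        (∑ j ∈ Finset.range (d - 5), (Nat.choose (f - 1 - 6) j : ℚ) / (((j + 1) + 3 * (j + 1).choose 2 + 3 * (j + 1).choose 3 + 2 * (j + 1).choose 4 : ℕ) : ℚ))) *
        ((N6 : ℚ) / 6) := by
  classical
  have hL0 : ∀ e ∈ M.E, ¬ M.IsLoop e := not_isLoop_of_free M hfree
  have hs : ∀ e ∈ M.E, ∀ f ∈ M.E, e ≠ f → M.eRk {e, f} = 2 := by
    intro e he f hf hef
    have h2 : (2 : ℕ∞) ≤ M.eRk {e, f} :=
      two_le_eRk_of_two_le_ncard_of_free M hfree (pair_subset he hf) (by rw [ncard_pair hef])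
    have h3 : M.eRk {e, f} ≤ 2 := by
      have := M.eRk_le_encard {e, f}
      rwa [encard_pair hef] at this
    exact le_antisymm h3 h2
  have hcirc : ∀ C, M.IsCircuit C → 3 ≤ C.encard := three_le_encard_of_circuit M hL0 hs
  have hd : M.E.encard = M.eRank + d := by
    rw [hR, ← M.ground_finite.cast_ncard_eq, hn]
    push_cast
    ring
  have hC1 : ∀ L ⊆ M.E, M.eRk L = 2 → L.ncard ≤ 3 :=
    fun L hL hr => ncard_le_three_of_eRk_two M hs hfree hL hr
  have hC2 : ∀ P ⊆ M.E, M.eRk P ≤ 3 → P.ncard ≤ 6 :=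
    fun P hP hr => ncard_le_six_of_eRk_le_three_of_free M hfree hP hr
  have hs6 : {C | M.IsCircuit C ∧ C.ncard = 6}.ncard ≤ (d + 5).choose 6 :=
    Matroid.ncard_circuits_le_choose_of_encard M hd 5
  set Nm := ((S2.spanAll M 5).filter (fun S => (M.closure S).ncard = f)).card with hNm
  have hU0 := S2.ncard_eRk_eq_ncard_le_le_sets_indep_graded M 5 f d (by norm_num) hcirc hC1 hC2 hflat Nm le_rfl
  have hU1 := S2.topCount_le_ncard_compl_spanning (M := M) hR hd 5
  have hsplit := S2.ncard_spanning_level_add_le_split (M := M) 5 d (by omega)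
  simp only [show (5 : ℕ) + 1 = 6 from rfl] at hU0
  rw [hn, sum_Icc_three_six_q, show d - 6 + 1 = d - 5 by omega] at hU0
  simp only [show (6 : ℕ) - 3 = 3 from rfl, show (6 : ℕ) - 4 = 2 from rfl,
    show (6 : ℕ) - 5 = 1 from rfl, show (6 : ℕ) - 6 = 0 from rfl, Nat.choose_one_right,
    Nat.choose_zero_right] at hU0
  set σl : ℚ := ∑ j ∈ Finset.range (d - 5), (Nat.choose (f - 1 - 6) j : ℚ) / (((j + 1) + 3 * (j + 1).choose 2 + 3 * (j + 1).choose 3 + 2 * (j + 1).choose 4 : ℕ) : ℚ) with hσldef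
  set σh : ℚ := ∑ j ∈ Finset.range (d - 5), (Nat.choose (f - 6) j : ℚ) / (((j + 1) + 3 * (j + 1).choose 2 + 3 * (j + 1).choose 3 + 2 * (j + 1).choose 4 : ℕ) : ℚ) with hσhdef
  have hsm : {C | M.IsCircuit C ∧ C.ncard = 3}.ncard * (p + d - 3).choose 3 +
      {C | M.IsCircuit C ∧ C.ncard = 4}.ncard * (p + d - 4).choose 2 +
      {C | M.IsCircuit C ∧ C.ncard = 5}.ncard * (p + d - 5) + {C | M.IsCircuit C ∧ C.ncard = 6}.ncard * 1 ≤
      s3b * (p + d - 3).choose 3 + s4b * (p + d - 4).choose 2 + s5b * (p + d - 5) + (d + 5).choose 6 := by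
    have := hs6
    gcongr
    omega
  have hsmq : (({C | M.IsCircuit C ∧ C.ncard = 3}.ncard : ℚ) * ((p + d - 3).choose 3 : ℚ) +
      ({C | M.IsCircuit C ∧ C.ncard = 4}.ncard : ℚ) * ((p + d - 4).choose 2 : ℚ) +
      ({C | M.IsCircuit C ∧ C.ncard = 5}.ncard : ℚ) * ((p + d - 5 : ℕ) : ℚ) +
      ({C | M.IsCircuit C ∧ C.ncard = 6}.ncard : ℚ) * ((1 : ℕ) : ℚ)) ≤
      ((s3b * (p + d - 3).choose 3 + s4b * (p + d - 4).choose 2 + s5b * (p + d - 5) + (d + 5).choose 6 : ℕ) : ℚ) := by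
    exact_mod_cast hsm
  have hσl0 : (0 : ℚ) ≤ σl := Finset.sum_nonneg (fun j _ => by positivity)
  have hlh : σl ≤ σh := by
    apply Finset.sum_le_sum
    intro j _
    have : (f - 1 - 6).choose j ≤ (f - 6).choose j := Nat.choose_le_choose j (by omega)
    have h' : ((f - 1 - 6).choose j : ℚ) ≤ ((f - 6).choose j : ℚ) := by exact_mod_cast this
    exact div_le_div_of_nonneg_right h' (by positivity)
  have hNmq : (Nm : ℚ) ≤ (N6 : ℚ) / 6 := by
    rw [le_div_iff₀ (by norm_num : (0 : ℚ) < 6)]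
    exact_mod_cast hN6
  have hU1q : (Matroid.topCount M p 5 : ℚ) ≤
      ({B : Set α | B ⊆ M.E ∧ M.eRk B = 5 ∧ B.ncard ≤ d ∧ M.eRk (M.E \ B) = M.eRank}.ncard : ℚ) := by
    exact_mod_cast hU1
  have hsplitq : ({B : Set α | B ⊆ M.E ∧ M.eRk B = 5 ∧ B.ncard ≤ d ∧ M.eRk (M.E \ B) = M.eRank}.ncard : ℚ) +
      ({B : Set α | B ⊆ M.E ∧ B.ncard = 5 ∧ M.eRk B = 5}.ncard : ℚ) ≤
      ({B : Set α | B ⊆ M.E ∧ B.ncard = 5 ∧ M.eRk (M.E \ B) = M.eRank}.ncard : ℚ) +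
      ({B : Set α | B ⊆ M.E ∧ M.eRk B = 5 ∧ B.ncard ≤ d}.ncard : ℚ) := by
    exact_mod_cast hsplit
  have hVq : ({B : Set α | B ⊆ M.E ∧ B.ncard = 5 ∧ M.eRk (M.E \ B) = M.eRank}.ncard : ℚ) ≤ (V : ℚ) := by
    exact_mod_cast hV
  have e1 := mul_le_mul_of_nonneg_left hsmq hσl0
  have e2 := mul_le_mul_of_nonneg_left hNmq (by linarith : (0 : ℚ) ≤ σh - σl)
  push_cast at e1 hU0 ⊢
  linarith [hU1q, hsplitq, hVq, hU0, e1, e2]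

open scoped Classical in
/-- **The top count at level `5` by the graded partition count, with the maximal-closure sets counted through the circuits**
(S2MaxExtensionCount): `N6 = s3b·((n − 3)² − (n − 3))·e + 3·s4b·(n − 4)·e + 6·s5b·e + 6·C(d + 5, 6)` whenever `e` bounds the
maximal extensions of every rank-`4` flat with `≥ 5` points. -/
theorem topCount_le_payment_graded_of_ext (M : Matroid α) [M.Finite] (p d : ℕ) (hd6 : 6 ≤ d)
    (hR : M.eRank = (p : ℕ∞)) (hn : M.E.ncard = p + d)
    (hfree : ∀ e ∈ M.E, ∃ A ⊆ M.E \ {e}, e ∉ M.closure A ∧ e ∉ M.closure ((M.E \ {e}) \ A))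
    (f : ℕ) (hflat : ∀ X ⊆ M.E, M.eRk X ≤ 5 → X.ncard ≤ f)
    (s3b s4b s5b : ℕ) (hs3 : {C : Set α | M.IsCircuit C ∧ C.ncard = 3}.ncard ≤ s3b)
    (hs4 : {C : Set α | M.IsCircuit C ∧ C.ncard = 4}.ncard ≤ s4b)
    (hs5 : {C : Set α | M.IsCircuit C ∧ C.ncard = 5}.ncard ≤ s5b)
    (e : ℕ) (he : ∀ P ⊆ M.E, M.closure P = P → M.eRk P = 4 → 5 ≤ P.ncard →
      ({x ∈ M.E \ P | (M.closure (insert x P)).ncard = f}).ncard ≤ e)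
    (V : ℕ) (hV : {B : Set α | B ⊆ M.E ∧ B.ncard = 5 ∧ M.eRk (M.E \ B) = M.eRank}.ncard ≤ V) :
    (Matroid.topCount M p 5 : ℚ) ≤ (V : ℚ) +
      (∑ j ∈ Finset.range (d - 5), (Nat.choose (f - 1 - 6) j : ℚ) / (((j + 1) + 3 * (j + 1).choose 2 + 3 * (j + 1).choose 3 + 2 * (j + 1).choose 4 : ℕ) : ℚ)) *
        ((s3b * (p + d - 3).choose 3 + s4b * (p + d - 4).choose 2 +
          s5b * (p + d - 5) + (d + 5).choose 6 : ℕ) : ℚ) +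
      ((∑ j ∈ Finset.range (d - 5), (Nat.choose (f - 6) j : ℚ) / (((j + 1) + 3 * (j + 1).choose 2 + 3 * (j + 1).choose 3 + 2 * (j + 1).choose 4 : ℕ) : ℚ)) -
        (∑ j ∈ Finset.range (d - 5), (Nat.choose (f - 1 - 6) j : ℚ) / (((j + 1) + 3 * (j + 1).choose 2 + 3 * (j + 1).choose 3 + 2 * (j + 1).choose 4 : ℕ) : ℚ))) *
        (((s3b * (((p + d - 3) * (p + d - 3) - (p + d - 3)) * e) + s4b * (3 * ((p + d - 4) * e)) + s5b * (6 * e) +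
          (d + 5).choose 6 * 6 : ℕ) : ℚ) / 6) := by
  classical
  have hL0 : ∀ e ∈ M.E, ¬ M.IsLoop e := not_isLoop_of_free M hfree
  have hs : ∀ e ∈ M.E, ∀ f ∈ M.E, e ≠ f → M.eRk {e, f} = 2 := by
    intro e he f hf hef
    have h2 : (2 : ℕ∞) ≤ M.eRk {e, f} :=
      two_le_eRk_of_two_le_ncard_of_free M hfree (pair_subset he hf) (by rw [ncard_pair hef])
    have h3 : M.eRk {e, f} ≤ 2 := by
      have := M.eRk_le_encard {e, f}
      rwa [encard_pair hef] at this
    exact le_antisymm h3 h2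
  have hcirc : ∀ C, M.IsCircuit C → 3 ≤ C.encard := three_le_encard_of_circuit M hL0 hs
  have hd : M.E.encard = M.eRank + d := by
    rw [hR, ← M.ground_finite.cast_ncard_eq, hn]
    push_cast
    ring
  have hs6 : {C | M.IsCircuit C ∧ C.ncard = 6}.ncard ≤ (d + 5).choose 6 :=
    Matroid.ncard_circuits_le_choose_of_encard M hd 5
  have hN := S2.card_spanMax_mul_six_le (M := M) f e hcirc he
  rw [hn] at hN
  refine topCount_le_payment_graded M p d hd6 hR hn hfree f hflat s3b s4b s5b hs3 hs4 hs5 _ (hN.trans ?_) V hV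
  gcongr

end ThmN

end PercRepro
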